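import Literature.Analysis.FluidPDE.NormalisedPressureLpClass
import Literature.Analysis.FluidPDE.PressureNormalisationLp
import HarnessLib

/-!
# The difference of two Riesz-transform pressures (mixed exponents) and the pressure of the remainder equation

Analysis/FluidPDE proofs file (theorems only) on the discharge path of the corrected form of
`Literature.Analysis.FluidPDE.albritton_singular_point_of_blowup` (Albritton 2018, Cor. 4.6 over
Albritton's class). In the energy estimate for the remainder `W = v − V` of the Calderón
splitting (proof of Prop. 4.5, (4.32)–(4.33)) the pressure difference `p̃[v] − p̃[V]` must be
square integrable although neither `p̃[v]` nor `p̃[V]` is (`v, V ∈ L^p ∩ L^∞`, `p > 3`): it is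
bilinear in `(W, v + V)` with `|W|(|v| + |V|) ∈ L²`.

* §1 `exists_normalisedPressure_sub_memLp` — the general-exponent form of the accepted
  `exists_normalisedPressure_sub_eq_add₃` (there: `|a|², |b|² ∈ L^{3/2}`, pieces in `L²` and
  `L^{3/2}`): for `1 < P, r < ∞`, measurable `a, b` with `|a|², |b|² ∈ L^P` (existence a.e. of the
  principal values) and `|a − b||b|, |a − b|² ∈ L^r`, there is a measurable `Q` with
  `p̃[a] − p̃[b] = Q` a.e. and `‖Q‖_r ≤ C_r (‖|a − b||b|‖_r + ‖|a − b|²‖_r)`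
  (`p̃[a] − p̃[b] = −⟨c, a + b⟩/3 + p.v.∫ B(c, a + b)`, `c = a − b`, `a + b = 2b + c`; the bilinear
  Calderón–Zygmund inequality `exists_bilinear_pv` at the exponent `r`).

* §2 `pressure_ae_eq_normalisedPressure_add_const` — for a classical solution `(u, p)` of the
  unforced system on `(t₁, t₂)` with `‖u(t)‖_{L^{2P}} ≤ M` (`1 < P < ∞`) and pressure of moderate
  growth, `p(t) = p̃[u(t)] + C(t)` a.e. (the accepted `PressureNormalisationLp.pressure_ae_eq_add_const`
  with the candidate `p̃[u(t)]`, a weak-Poisson solution by the accepted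
  `integral_normalisedPressure_mul_laplacian_of_memLp`, in `L^P` by Stein's bound).
* §3 `exists_sq_integrable_pressure_sub` — for two such solutions `(v, π_v)`, `(V, π_V)`, bounded,
  with `W = v − V ∈ L²` slicewise: `π_v(t) − π_V(t) − c_t ∈ L²` with
  `∫ |π_v(t) − π_V(t) − c_t|² ≤ (C (M_v + 2M) Λ)²` — the pressure hypothesis of
  `PerturbedEnergyInequality.energy_inequality`.

## References

* D. Albritton, Anal. PDE 11 (2018) = arXiv:1612.04439, proof of Prop. 4.5. [Albritton2018]
* E. M. Stein, *Singular Integrals and Differentiability Properties of Functions* (1970),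
  Ch. II §4.2 Thm 3, §4.5 Thm 4. [Stein1970]
* P. G. Lemarié-Rieusset, *The Navier–Stokes Problem in the 21st Century* (2016), proof of
  Thm. 14.7 (the same decomposition at `L^{3/2}`/`L²`). [LemarieRieusset2016]
-/

noncomputable section

open MeasureTheory Set Filter Topology Function Metric
open scoped ENNReal NNReal RealInnerProductSpace

namespace Literature.Analysis.FluidPDE

namespace NormalisedPressureDifferenceMixed

/-! ### §1 The difference of two normalised pressures, general exponents -/

/-- **The difference of two Riesz-transform pressures in `L^r`.** For `1 < P < ∞` and
`1 < r < ∞` there is a constant `C` such that: for measurable fields `a, b` on `ℝ³` with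
`|a|², |b|² ∈ L^P` and `|a − b||b|, |a − b||a − b| ∈ L^r`, there is a measurable `Q` with
`p̃[a] − p̃[b] = Q` a.e. and `‖Q‖_r ≤ C (‖|a − b||b|‖_r + ‖|a − b||a − b|‖_r)`
(`Q = −⅔⟨c, b⟩ − ⅓|c|² + 2 p.v.∫B(c, b) + p.v.∫B(c, c)`, `c = a − b`; the general-exponent
form of `exists_normalisedPressure_sub_eq_add₃`). [cite: Stein1970, Ch. II §4.2 Thm 3 and §4.5 Thm 4; LemarieRieusset2016, Thm. 14.7, proof] -/
theorem exists_normalisedPressure_sub_memLp {P r : ℝ≥0∞} (hP1 : 1 < P) (hPt : P < ⊤) (hr1 : 1 < r)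
    (hrt : r < ⊤) :
    ∃ C : ℝ≥0∞, C ≠ ⊤ ∧ ∀ (a b : (EuclideanSpace ℝ (Fin 3)) → (EuclideanSpace ℝ (Fin 3))),
      AEStronglyMeasurable a volume → AEStronglyMeasurable b volume →
      MemLp (fun y => ‖a y‖ ^ 2) P volume → MemLp (fun y => ‖b y‖ ^ 2) P volume →
      MemLp (fun y => ‖a y - b y‖ * ‖b y‖) r volume →
      MemLp (fun y => ‖a y - b y‖ * ‖a y - b y‖) r volume →
      ∃ Q : (EuclideanSpace ℝ (Fin 3)) → ℝ, AEStronglyMeasurable Q volume ∧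
        ((fun x => normalisedPressure a x - normalisedPressure b x) =ᵐ[volume] Q) ∧
        eLpNorm Q r volume ≤ C * (eLpNorm (fun y => ‖a y - b y‖ * ‖b y‖) r volume +
          eLpNorm (fun y => ‖a y - b y‖ * ‖a y - b y‖) r volume) := by
  obtain ⟨A, hAt, hA⟩ := exists_eLpNorm_rieszTrunc_le (p := r) hr1 hrt
  set K : ℝ≥0∞ := 27 * 2⁻¹ * A with hK
  have hKt : K ≠ ⊤ := by simp only [hK]; finiteness
  set C : ℝ≥0∞ := 2 * 3⁻¹ + 2 * K + (3⁻¹ + K) with hC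
  have hCt : C ≠ ⊤ := by simp only [hC]; finiteness
  refine ⟨C, hCt, fun a b ha hb ha2 hb2 hcb hcc => ?_⟩
  -- abbreviations
  set c : (EuclideanSpace ℝ (Fin 3)) → (EuclideanSpace ℝ (Fin 3)) := fun y => a y - b y with hc
  have hcm : AEStronglyMeasurable c volume := ha.sub hb
  -- `|c|² ∈ L^P` as well (for the truncations at exponent `P`)
  have hccP : MemLp (fun y => ‖c y‖ * ‖c y‖) P volume := by
    have hsum : MemLp (fun y => 2 * ‖a y‖ ^ 2 + 2 * ‖b y‖ ^ 2) P volume :=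
      (ha2.const_mul 2).add (hb2.const_mul 2)
    refine hsum.of_le (hcm.norm.mul hcm.norm) (Eventually.of_forall fun y => ?_)
    rw [Real.norm_eq_abs, Real.norm_eq_abs, abs_of_nonneg (by positivity), abs_of_nonneg (by positivity)]
    have h := norm_sub_le (a y) (b y)
    have h' : ‖c y‖ * ‖c y‖ ≤ (‖a y‖ + ‖b y‖) * (‖a y‖ + ‖b y‖) :=
      mul_le_mul h h (norm_nonneg _) (by positivity)
    nlinarith [sq_nonneg (‖a y‖ - ‖b y‖)]
  -- the two bilinear principal values (exponent `r`)
  obtain ⟨P₁, hP₁m, hP₁, hP₁b⟩ := exists_bilinear_pv (f := c) (g := b) hr1 hrt hA hcm hb hcb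
  obtain ⟨P₂, hP₂m, hP₂, hP₂b⟩ := exists_bilinear_pv (f := c) (g := c) hr1 hrt hA hcm hcm hcc
  -- the principal values of `a` and `b` exist a.e. (exponent `P`)
  have hPVa := ae_exists_hasPressurePV hP1 hPt ha ha2
  have hPVb := ae_exists_hasPressurePV hP1 hPt hb hb2
  -- the candidate
  set Q : (EuclideanSpace ℝ (Fin 3)) → ℝ :=
    fun x => (-(2 * 3⁻¹) * ⟪c x, b x⟫ + 2 * P₁ x) + (-(3⁻¹) * ⟪c x, c x⟫ + P₂ x) with hQ
  have hQ₁m : AEStronglyMeasurable (fun x => -(2 * 3⁻¹) * ⟪c x, b x⟫ + 2 * P₁ x) volume :=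
    ((hcm.inner hb).const_mul _).add (hP₁m.const_mul _)
  have hQ₂m : AEStronglyMeasurable (fun x => -(3⁻¹) * ⟪c x, c x⟫ + P₂ x) volume :=
    ((hcm.inner hcm).const_mul _).add hP₂m
  have hQm : AEStronglyMeasurable Q volume := hQ₁m.add hQ₂m
  refine ⟨Q, hQm, ?_, ?_⟩
  · -- ## the identity a.e.
    set qP : ℝ≥0∞ := ENNReal.conjExponent P with hqP
    haveI hpqP : ENNReal.HolderConjugate P qP := ENNReal.HolderConjugate.conjExponent hP1.le
    have hqP1 : 1 < qP := (ENNReal.HolderConjugate.lt_top_iff_one_lt P qP).1 hPt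
    have hqPt : qP ≠ ⊤ := (ENNReal.HolderConjugate.ne_top_iff_ne_one qP P).2 (ne_of_gt hP1)
    set qr : ℝ≥0∞ := ENNReal.conjExponent r with hqr
    haveI hpqr : ENNReal.HolderConjugate r qr := ENNReal.HolderConjugate.conjExponent hr1.le
    have hqr1 : 1 < qr := (ENNReal.HolderConjugate.lt_top_iff_one_lt r qr).1 hrt
    have hqrt : qr ≠ ⊤ := (ENNReal.HolderConjugate.ne_top_iff_ne_one qr r).2 (ne_of_gt hr1)
    filter_upwards [hPVa, hPVb, hP₁, hP₂] with x hxa hxb hx₁ hx₂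
    obtain ⟨La, hLa⟩ := hxa
    obtain ⟨Lb, hLb⟩ := hxb
    -- the truncations of the difference, for `ε > 0`
    have htrunc : ∀ ε : ℝ, 0 < ε → truncatedPressureIntegral a x ε - truncatedPressureIntegral b x ε =
        2 * (∫ y in (closedBall x ε)ᶜ, pressureForm (x - y) (c y) (b y)) +
          ∫ y in (closedBall x ε)ᶜ, pressureForm (x - y) (c y) (c y) := by
      intro ε hε
      have hIa := integrableOn_pressureKernel_of_memLp hqP1 hqPt ha ha2 x hε
      have hIb := integrableOn_pressureKernel_of_memLp hqP1 hqPt hb hb2 x hε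
      have hI₁ := integrableOn_pressureForm_of_memLp hqr1 hqrt hcm hb hcb x hε
      have hI₂ := integrableOn_pressureForm_of_memLp hqr1 hqrt hcm hcm hcc x hε
      rw [truncatedPressureIntegral_sub_eq hIa hIb]
      have hpt : ∀ y, pressureForm (x - y) ((a - b) y) ((a + b) y) =
          2 * pressureForm (x - y) (c y) (b y) + pressureForm (x - y) (c y) (c y) := by
        intro y
        have hsum : (a + b) y = (2 : ℝ) • b y + c y := by
          simp only [Pi.add_apply, hc, two_smul]
          abel
        rw [hsum, pressureForm_add_right, pressureForm_smul_right]
        rfl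
      rw [integral_congr_ae (Eventually.of_forall hpt), integral_add (hI₁.const_mul 2) hI₂,
        integral_const_mul]
    -- pass to the limit `ε → 0⁺`
    have hlim : Tendsto (fun ε => truncatedPressureIntegral a x ε - truncatedPressureIntegral b x ε) (𝓝[>] 0)
        (𝓝 (2 * P₁ x + P₂ x)) := by
      have h := (hx₁.const_mul 2).add hx₂
      refine h.congr' ?_
      filter_upwards [self_mem_nhdsWithin] with ε hε
      exact (htrunc ε hε).symm
    have hlim' : Tendsto (fun ε => truncatedPressureIntegral a x ε - truncatedPressureIntegral b x ε) (𝓝[>] 0)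
        (𝓝 (La - Lb)) := hLa.2.sub hLb.2
    have hLL : La - Lb = 2 * P₁ x + P₂ x := tendsto_nhds_unique hlim' hlim
    show normalisedPressure a x - normalisedPressure b x = Q x
    rw [normalisedPressure_sub_eq hLa hLb, hLL, norm_sq_sub_norm_sq_eq_inner]
    have hsum : a x + b x = (2 : ℝ) • b x + c x := by
      simp only [hc, two_smul]
      abel
    have hcx : a x - b x = c x := rfl
    rw [hcx, hsum, inner_add_right, real_inner_smul_right]
    simp only [hQ]
    ring
  · -- ## the `L^r` bound
    have h1le : (1 : ℝ≥0∞) ≤ r := hr1.le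
    have hm1 : AEStronglyMeasurable (fun x => -(2 * 3⁻¹) * ⟪c x, b x⟫) volume := (hcm.inner hb).const_mul _
    have hm2 : AEStronglyMeasurable (fun x => 2 * P₁ x) volume := hP₁m.const_mul _
    have hm3 : AEStronglyMeasurable (fun x => -(3⁻¹) * ⟪c x, c x⟫) volume := (hcm.inner hcm).const_mul _
    have hb1 : eLpNorm (fun x => -(2 * 3⁻¹) * ⟪c x, b x⟫ + 2 * P₁ x) r volume ≤
        (2 * 3⁻¹ + 2 * K) * eLpNorm (fun y => ‖c y‖ * ‖b y‖) r volume := by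
      calc eLpNorm (fun x => -(2 * 3⁻¹) * ⟪c x, b x⟫ + 2 * P₁ x) r volume
          ≤ eLpNorm (fun x => -(2 * 3⁻¹) * ⟪c x, b x⟫) r volume + eLpNorm (fun x => 2 * P₁ x) r volume :=
            eLpNorm_add_le hm1 hm2 h1le
        _ ≤ 2 * 3⁻¹ * eLpNorm (fun y => ‖c y‖ * ‖b y‖) r volume + 2 * (K * eLpNorm (fun y => ‖c y‖ * ‖b y‖) r volume) := by
            gcongr
            · have e1 : (fun x => -(2 * 3⁻¹) * ⟪c x, b x⟫) = (-(2 * 3⁻¹) : ℝ) • fun x => ⟪c x, b x⟫ := by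
                funext x; simp only [Pi.smul_apply, smul_eq_mul]
              rw [e1, eLpNorm_const_smul, enorm_neg, Real.enorm_eq_ofReal (by norm_num),
                ENNReal.ofReal_mul zero_le_two, ENNReal.ofReal_inv_of_pos (by norm_num), ENNReal.ofReal_ofNat,
                ENNReal.ofReal_ofNat]
              exact mul_le_mul' le_rfl (eLpNorm_inner_le c b r)
            · have e2 : (fun x => 2 * P₁ x) = (2 : ℝ) • P₁ := by
                funext x; simp only [Pi.smul_apply, smul_eq_mul]
              rw [e2, eLpNorm_const_smul, Real.enorm_eq_ofReal zero_le_two, ENNReal.ofReal_ofNat]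
              exact mul_le_mul' le_rfl hP₁b
        _ = (2 * 3⁻¹ + 2 * K) * eLpNorm (fun y => ‖c y‖ * ‖b y‖) r volume := by
            rw [← mul_assoc, ← add_mul]
    have hb2' : eLpNorm (fun x => -(3⁻¹) * ⟪c x, c x⟫ + P₂ x) r volume ≤
        (3⁻¹ + K) * eLpNorm (fun y => ‖c y‖ * ‖c y‖) r volume := by
      calc eLpNorm (fun x => -(3⁻¹) * ⟪c x, c x⟫ + P₂ x) r volume
          ≤ eLpNorm (fun x => -(3⁻¹) * ⟪c x, c x⟫) r volume + eLpNorm P₂ r volume :=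
            eLpNorm_add_le hm3 hP₂m h1le
        _ ≤ 3⁻¹ * eLpNorm (fun y => ‖c y‖ * ‖c y‖) r volume + K * eLpNorm (fun y => ‖c y‖ * ‖c y‖) r volume := by
            gcongr
            · have e1 : (fun x => -(3⁻¹) * ⟪c x, c x⟫) = (-(3⁻¹) : ℝ) • fun x => ⟪c x, c x⟫ := by
                funext x; simp only [Pi.smul_apply, smul_eq_mul]
              rw [e1, eLpNorm_const_smul, enorm_neg, Real.enorm_eq_ofReal (by norm_num),
                ENNReal.ofReal_inv_of_pos (by norm_num), ENNReal.ofReal_ofNat]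
              exact mul_le_mul' le_rfl (eLpNorm_inner_le c c r)
        _ = (3⁻¹ + K) * eLpNorm (fun y => ‖c y‖ * ‖c y‖) r volume := by rw [← add_mul]
    calc eLpNorm Q r volume
        ≤ eLpNorm (fun x => -(2 * 3⁻¹) * ⟪c x, b x⟫ + 2 * P₁ x) r volume +
            eLpNorm (fun x => -(3⁻¹) * ⟪c x, c x⟫ + P₂ x) r volume := eLpNorm_add_le hQ₁m hQ₂m h1le
      _ ≤ (2 * 3⁻¹ + 2 * K) * eLpNorm (fun y => ‖c y‖ * ‖b y‖) r volume +
            (3⁻¹ + K) * eLpNorm (fun y => ‖c y‖ * ‖c y‖) r volume := add_le_add hb1 hb2'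
      _ ≤ C * eLpNorm (fun y => ‖c y‖ * ‖b y‖) r volume + C * eLpNorm (fun y => ‖c y‖ * ‖c y‖) r volume := by
          gcongr
          · simp only [hC]; exact le_self_add
          · simp only [hC]; exact le_add_self
      _ = C * (eLpNorm (fun y => ‖c y‖ * ‖b y‖) r volume + eLpNorm (fun y => ‖c y‖ * ‖c y‖) r volume) := by
          rw [mul_add]

/-! ### §2 The pressure of a classical solution with `L^{2P}` slices is `p̃[u] + C(t)` -/

section Classical

open scoped Laplacian

variable {ν : ℝ} {u : ℝ → (EuclideanSpace ℝ (Fin 3)) → (EuclideanSpace ℝ (Fin 3))}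
  {p : ℝ → (EuclideanSpace ℝ (Fin 3)) → ℝ} {t₁ t₂ : ℝ}

/-- **`p(t) = p̃[u(t)] + C(t)` a.e.** for a classical solution of the unforced system on `(t₁, t₂)`
(`ν ≥ 0`, pressure of growth `o(|x|)` as recorded in `IsClassicalNSSolutionOn`) whose velocity
slices are bounded in `L^{2P}`, `1 < P < ∞`: the accepted normalisation theorem
`PressureNormalisationLp.pressure_ae_eq_add_const` with the Riesz-transform pressure `p̃[u(t)]` as
the weak-Poisson candidate (`integral_normalisedPressure_mul_laplacian_of_memLp`,
`memLp_normalisedPressure_of_memLp_two_mul`, Stein's bound `exists_eLpNorm_normalisedPressure_le_sq`).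
[cite: Tao2011, Lemma 4.1 (i); Stein1970, Ch. II §4.2 Thm 3] -/
theorem pressure_ae_eq_normalisedPressure_add_const (hν : 0 ≤ ν)
    (h : IsClassicalNSSolutionOn (Ioo t₁ t₂) ν 0 u p) {P : ℝ≥0∞} (hP1 : 1 < P) (hP : P < ⊤)
    (hu : ∀ t ∈ Ioo t₁ t₂, MemLp (u t) (2 * P) volume) {M : ℝ≥0}
    (hM : ∀ t ∈ Ioo t₁ t₂, eLpNorm (u t) (2 * P) volume ≤ M) {t : ℝ} (ht : t ∈ Ioo t₁ t₂) :
    ∃ C : ℝ, ∀ᵐ x ∂(volume : Measure (EuclideanSpace ℝ (Fin 3))),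
      p t x = normalisedPressure (u t) x + C := by
  obtain ⟨Cs, hCs⟩ := exists_eLpNorm_normalisedPressure_le_sq (p := P) hP1 hP
  have hu' : ∀ s ∈ Ioo t₁ t₂, MemLp (u s) (P * 2) volume := fun s hs => by
    rw [mul_comm]; exact hu s hs
  have hM' : ∀ s ∈ Ioo t₁ t₂, (eLpNorm (u s) (P * 2) volume).toReal ≤ M := fun s hs => by
    rw [mul_comm]
    have h1 : (eLpNorm (u s) (2 * P) volume).toReal ≤ ((M : ℝ≥0∞)).toReal :=
      ENNReal.toReal_mono ENNReal.coe_ne_top (hM s hs)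
    simpa using h1
  have hQ : ∀ s ∈ Ioo t₁ t₂, MemLp (normalisedPressure (u s)) P volume := fun s hs =>
    memLp_normalisedPressure_of_memLp_two_mul hP1 hP (hu s hs)
  have hN : ∀ s ∈ Ioo t₁ t₂, (eLpNorm (normalisedPressure (u s)) P volume).toReal ≤
      (Cs : ℝ) * (M : ℝ) ^ 2 := by
    intro s hs
    have h1 : eLpNorm (normalisedPressure (u s)) P volume ≤ Cs * (M : ℝ≥0∞) ^ 2 :=
      (hCs (u s) (hu s hs)).trans (mul_le_mul' le_rfl (pow_le_pow_left' (hM s hs) 2))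
    have h2 := ENNReal.toReal_mono (by finiteness) h1
    simpa [ENNReal.toReal_mul, ENNReal.toReal_pow] using h2
  have hQP : ∀ s ∈ Ioo t₁ t₂, ∀ ψ : (EuclideanSpace ℝ (Fin 3)) → ℝ, ContDiff ℝ (⊤ : ℕ∞) ψ →
      HasCompactSupport ψ →
      ∫ y, normalisedPressure (u s) y * (Δ ψ) y = -∫ y, fderiv ℝ (fderiv ℝ ψ) y (u s y) (u s y) :=
    fun s hs ψ hψ hψc => integral_normalisedPressure_mul_laplacian_of_memLp hP1 hP (hu s hs) hψ hψc
  exact PressureNormalisationLp.pressure_ae_eq_add_const hν h hP1.le hP.ne hu' hM'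
    (Q := fun s => normalisedPressure (u s)) hQ hN hQP ht

end Classical

/-! ### §3 The pressure hypothesis of the energy inequality -/

section Remainder

open scoped Laplacian

/-- `∫ f² ≤ B²` when `‖f‖_{L²} ≤ B` (real-valued `f ∈ L²`). [folklore] -/
theorem integral_sq_le_of_eLpNorm_le {f : (EuclideanSpace ℝ (Fin 3)) → ℝ} (hf : MemLp f 2 volume)
    {B : ℝ} (hB : 0 ≤ B) (h : eLpNorm f 2 volume ≤ ENNReal.ofReal B) :
    Integrable (fun x => f x ^ 2) volume ∧ ∫ x, f x ^ 2 ≤ B ^ 2 := by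
  refine ⟨hf.integrable_sq, ?_⟩
  have h1 := hf.eLpNorm_eq_integral_rpow_norm two_ne_zero ENNReal.ofNat_ne_top
  simp only [ENNReal.toReal_ofNat] at h1
  have hI0 : 0 ≤ ∫ a, ‖f a‖ ^ (2 : ℝ) := integral_nonneg fun a => by positivity
  rw [h1] at h
  have h2 : (∫ a, ‖f a‖ ^ (2 : ℝ)) ^ (2 : ℝ)⁻¹ ≤ B := (ENNReal.ofReal_le_ofReal_iff hB).1 h
  have h3 : ∫ a, ‖f a‖ ^ (2 : ℝ) ≤ B ^ 2 := by
    have h4 := Real.rpow_le_rpow (Real.rpow_nonneg hI0 _) h2 (by norm_num : (0 : ℝ) ≤ 2)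
    rw [← Real.rpow_mul hI0, inv_mul_cancel₀ two_ne_zero, Real.rpow_one, Real.rpow_two] at h4
    exact h4
  have e : ∫ x, f x ^ 2 = ∫ a, ‖f a‖ ^ (2 : ℝ) :=
    integral_congr_ae (Eventually.of_forall fun a => by
      show f a ^ 2 = ‖f a‖ ^ (2 : ℝ)
      rw [Real.rpow_two, Real.norm_eq_abs, sq_abs])
  rw [e]; exact h3

/-- **The pressure difference of two classical solutions with a square-integrable velocity
difference is square integrable up to a constant.** Let `(v, π_v)`, `(V, π_V)` solve the unforced
system (`ν ≥ 0`) classically on `(t₁, t₂)`, with `‖v(t)‖_{L^{2P}}, ‖V(t)‖_{L^{2P}} ≤ N`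
(`1 < P < ∞`), `|v| ≤ M_v`, `|V| ≤ M`, and `‖v(t) − V(t)‖_{L²} ≤ Λ`. Then for every `t` there is
`c_t` with `∫ |π_v(t) − π_V(t) − c_t|² ≤ (C (M_v + 2M) Λ)²`, `C = C_{P,2}` the constant of
`exists_normalisedPressure_sub_memLp` (§2: `π = p̃ + C(t)`; §1 with `r = 2`:
`|W||V| ≤ M|W|`, `|W|² ≤ (M_v + M)|W|`). [cite: Albritton2018, Prop. 4.5 proof, (4.32); Stein1970, Ch. II §4.2 Thm 3] -/
theorem exists_sq_integrable_pressure_sub {ν : ℝ} (hν : 0 ≤ ν) {P : ℝ≥0∞} (hP1 : 1 < P) (hP : P < ⊤) :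
    ∃ C : ℝ, 0 ≤ C ∧ ∀ (v V : ℝ → (EuclideanSpace ℝ (Fin 3)) → (EuclideanSpace ℝ (Fin 3)))
      (πv πV : ℝ → (EuclideanSpace ℝ (Fin 3)) → ℝ) (t₁ t₂ : ℝ),
      IsClassicalNSSolutionOn (Ioo t₁ t₂) ν 0 v πv → IsClassicalNSSolutionOn (Ioo t₁ t₂) ν 0 V πV →
      ∀ (N : ℝ≥0) (Mv M Λ : ℝ), 0 ≤ Mv → 0 ≤ M → 0 ≤ Λ →
      (∀ t ∈ Ioo t₁ t₂, MemLp (v t) (2 * P) volume ∧ eLpNorm (v t) (2 * P) volume ≤ N) →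
      (∀ t ∈ Ioo t₁ t₂, MemLp (V t) (2 * P) volume ∧ eLpNorm (V t) (2 * P) volume ≤ N) →
      (∀ t ∈ Ioo t₁ t₂, ∀ x, ‖v t x‖ ≤ Mv) → (∀ t ∈ Ioo t₁ t₂, ∀ x, ‖V t x‖ ≤ M) →
      (∀ t ∈ Ioo t₁ t₂, MemLp (fun x => v t x - V t x) 2 volume ∧
        eLpNorm (fun x => v t x - V t x) 2 volume ≤ ENNReal.ofReal Λ) →
      ∀ t ∈ Ioo t₁ t₂, ∃ c : ℝ, Integrable (fun x => (πv t x - πV t x - c) ^ 2) volume ∧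
        ∫ x, (πv t x - πV t x - c) ^ 2 ≤ (C * (Mv + 2 * M) * Λ) ^ 2 := by
  have h2_1 : (1 : ℝ≥0∞) < 2 := by norm_num
  have h2_t : (2 : ℝ≥0∞) < ⊤ := ENNReal.ofNat_lt_top
  obtain ⟨C, hCt, hC⟩ := exists_normalisedPressure_sub_memLp hP1 hP h2_1 h2_t
  refine ⟨C.toReal, ENNReal.toReal_nonneg,
    fun v V πv πV t₁ t₂ hv hV N Mv M Λ hMv hM hΛ hvN hVN hvM hVM hW t ht => ?_⟩
  have _ := hMv
  -- the two normalisations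
  obtain ⟨Cv, hCv⟩ := pressure_ae_eq_normalisedPressure_add_const hν hv hP1 hP
    (fun s hs => (hvN s hs).1) (fun s hs => (hvN s hs).2) ht
  obtain ⟨CV, hCV⟩ := pressure_ae_eq_normalisedPressure_add_const hν hV hP1 hP
    (fun s hs => (hVN s hs).1) (fun s hs => (hVN s hs).2) ht
  -- the data of §1 at time `t`
  set a := v t with ha
  set b := V t with hb
  have ham : AEStronglyMeasurable a volume := (hvN t ht).1.1
  have hbm : AEStronglyMeasurable b volume := (hVN t ht).1.1
  have ha2 : MemLp (fun y => ‖a y‖ ^ 2) P volume := memLp_norm_sq_of_memLp_two_mul (hvN t ht).1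
  have hb2 : MemLp (fun y => ‖b y‖ ^ 2) P volume := memLp_norm_sq_of_memLp_two_mul (hVN t ht).1
  have hWm : MemLp (fun y => a y - b y) 2 volume := (hW t ht).1
  have hMW : ∀ y, ‖a y - b y‖ ≤ Mv + M := fun y =>
    (norm_sub_le _ _).trans (add_le_add (hvM t ht y) (hVM t ht y))
  -- `|W||V| ≤ M |W|` and `|W||W| ≤ (Mv + M)|W|`, both in `L²`
  have hcb : MemLp (fun y => ‖a y - b y‖ * ‖b y‖) 2 volume := by
    refine (hWm.norm.const_mul M).of_le (hWm.1.norm.mul hbm.norm) (Eventually.of_forall fun y => ?_)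
    rw [Real.norm_eq_abs, Real.norm_eq_abs, abs_of_nonneg (by positivity), abs_of_nonneg (by positivity)]
    calc ‖a y - b y‖ * ‖b y‖ ≤ ‖a y - b y‖ * M := mul_le_mul_of_nonneg_left (hVM t ht y) (norm_nonneg _)
      _ = M * ‖a y - b y‖ := mul_comm _ _
  have hcc : MemLp (fun y => ‖a y - b y‖ * ‖a y - b y‖) 2 volume := by
    refine (hWm.norm.const_mul (Mv + M)).of_le (hWm.1.norm.mul hWm.1.norm)
      (Eventually.of_forall fun y => ?_)
    rw [Real.norm_eq_abs, Real.norm_eq_abs, abs_of_nonneg (by positivity), abs_of_nonneg (by positivity)]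
    calc ‖a y - b y‖ * ‖a y - b y‖ ≤ ‖a y - b y‖ * (Mv + M) :=
          mul_le_mul_of_nonneg_left (hMW y) (norm_nonneg _)
      _ = (Mv + M) * ‖a y - b y‖ := mul_comm _ _
  obtain ⟨Q, hQm, hQeq, hQb⟩ := hC a b ham hbm ha2 hb2 hcb hcc
  -- the `L²` norms of the two products
  have hn1 : eLpNorm (fun y => ‖a y - b y‖ * ‖b y‖) 2 volume ≤ ENNReal.ofReal (M * Λ) := by
    calc eLpNorm (fun y => ‖a y - b y‖ * ‖b y‖) 2 volume
        ≤ eLpNorm (fun y => M * ‖a y - b y‖) 2 volume := by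
          refine eLpNorm_mono_real fun y => ?_
          rw [Real.norm_eq_abs, abs_of_nonneg (by positivity), mul_comm]
          exact mul_le_mul_of_nonneg_right (hVM t ht y) (norm_nonneg _)
      _ = ENNReal.ofReal M * eLpNorm (fun y => a y - b y) 2 volume := by
          have e : (fun y => M * ‖a y - b y‖) = M • fun y => ‖a y - b y‖ := by
            funext y; simp [smul_eq_mul]
          rw [e, eLpNorm_const_smul, eLpNorm_norm, Real.enorm_eq_ofReal hM]
      _ ≤ ENNReal.ofReal M * ENNReal.ofReal Λ := mul_le_mul' le_rfl (hW t ht).2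
      _ = ENNReal.ofReal (M * Λ) := (ENNReal.ofReal_mul hM).symm
  have hn2 : eLpNorm (fun y => ‖a y - b y‖ * ‖a y - b y‖) 2 volume ≤
      ENNReal.ofReal ((Mv + M) * Λ) := by
    have hMvM : 0 ≤ Mv + M := by positivity
    calc eLpNorm (fun y => ‖a y - b y‖ * ‖a y - b y‖) 2 volume
        ≤ eLpNorm (fun y => (Mv + M) * ‖a y - b y‖) 2 volume := by
          refine eLpNorm_mono_real fun y => ?_
          rw [Real.norm_eq_abs, abs_of_nonneg (by positivity), mul_comm]
          exact mul_le_mul_of_nonneg_right (hMW y) (norm_nonneg _)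
      _ = ENNReal.ofReal (Mv + M) * eLpNorm (fun y => a y - b y) 2 volume := by
          have e : (fun y => (Mv + M) * ‖a y - b y‖) = (Mv + M) • fun y => ‖a y - b y‖ := by
            funext y; simp [smul_eq_mul]
          rw [e, eLpNorm_const_smul, eLpNorm_norm, Real.enorm_eq_ofReal hMvM]
      _ ≤ ENNReal.ofReal (Mv + M) * ENNReal.ofReal Λ := mul_le_mul' le_rfl (hW t ht).2
      _ = ENNReal.ofReal ((Mv + M) * Λ) := (ENNReal.ofReal_mul hMvM).symm
  have hQn : eLpNorm Q 2 volume ≤ ENNReal.ofReal (C.toReal * (Mv + 2 * M) * Λ) := by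
    set c : ℝ := C.toReal with hc
    have hc0 : 0 ≤ c := ENNReal.toReal_nonneg
    have hCe : C = ENNReal.ofReal c := (ENNReal.ofReal_toReal hCt).symm
    refine hQb.trans ?_
    rw [hCe]
    calc ENNReal.ofReal c * (eLpNorm (fun y => ‖a y - b y‖ * ‖b y‖) 2 volume +
          eLpNorm (fun y => ‖a y - b y‖ * ‖a y - b y‖) 2 volume)
        ≤ ENNReal.ofReal c * (ENNReal.ofReal (M * Λ) + ENNReal.ofReal ((Mv + M) * Λ)) :=
          mul_le_mul' le_rfl (add_le_add hn1 hn2)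
      _ = ENNReal.ofReal (c * (Mv + 2 * M) * Λ) := by
          have e : c * (M * Λ + (Mv + M) * Λ) = c * (Mv + 2 * M) * Λ := by ring
          rw [← ENNReal.ofReal_add (by positivity) (by positivity), ← ENNReal.ofReal_mul hc0, e]
  have hQ2 : MemLp Q 2 volume := ⟨hQm, hQn.trans_lt ENNReal.ofReal_lt_top⟩
  -- the constant and the identification `πv − πV − (Cv − CV) = Q` a.e.
  refine ⟨Cv - CV, ?_⟩
  have hae : (fun x => πv t x - πV t x - (Cv - CV)) =ᵐ[volume] Q := by
    filter_upwards [hCv, hCV, hQeq] with x hxv hxV hxQ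
    rw [hxv, hxV, ← hxQ]
    ring
  obtain ⟨hint, hle⟩ := integral_sq_le_of_eLpNorm_le hQ2 (by positivity) hQn
  have hae2 : (fun x => (πv t x - πV t x - (Cv - CV)) ^ 2) =ᵐ[volume] fun x => Q x ^ 2 :=
    hae.mono fun x hx => by
      have hx' : πv t x - πV t x - (Cv - CV) = Q x := hx
      show (πv t x - πV t x - (Cv - CV)) ^ 2 = Q x ^ 2
      rw [hx']
  refine ⟨hint.congr hae2.symm, ?_⟩
  rw [integral_congr_ae hae2]
  exact hle

end Remainder

end NormalisedPressureDifferenceMixed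

end Literature.Analysis.FluidPDE

end
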